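import Mathlib
import HarnessLib

/-!
# LINE (A) `product_plus_one` — the THREE-LETTER riser against a GENERAL PULL: no six zeros (abstract storey of the K = 4 cell)

Crux item stmt-ValiantsHypothesis-18050, every-K side (S5) of LINE (A) (val-idea-25 g3 label «THREE-LETTER RISER CELL (K = 4)», val-lit-p5 g15 memo
`pub/val-lit/lmr/NOTE-p5g15-18050-LINEA-K4-oneSigned-riser.md` §4).  This is ✓ `…OneRiserGeneralPull` (`oneRiser_no_four_zeros_of_pull`) + ✓ `…OneRiserLogistic`
(`logistic_crossings_le_two`) ONE STOREY HIGHER: a riser with THREE letters `H = b₁x^{d₁} + b₂x^{d₂} + b₃x^{d₃}` (`b_l > 0`, `d₁ < d₂ < d₃`, bottom letter `a`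
free) against ANY positive differentiable pull `Pl` on an interval `⊂ (0,∞)`.  With `θ = x·d/dx`, `Π₂ := Pl + θPl/Pl`, `Π₃ := Π₂ + θΠ₂/(Π₂ − d₁)`,
`Π₄ := Π₃ + θΠ₃/(Π₃ − d₂)` (the θ-division chain of the memo):

* `hasDerivAt_pow_mul_ratio` — the one calculus identity of the chain: `(t^n·(F − c)/(F − c₀))′ = n·t^{n−1}·((F − c)(F − c₀) + t·F′)/(F − c₀)²` when `n = c − c₀`;
* `threeLetter_alpha_hasDerivAt` — a-separation: `α := H − θH/Pl` has `α′ = G₁/(x·Pl)`, `G₁ = Σ_l b_l d_l x^{d_l}(Π₂ − d_l)`;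
* `exists_strictMono_deriv_zeros` — Rolle for an ordered tuple: `n + 2` ordered zeros of `f` with `f′ = g·D`, `g ≠ 0` ⇒ `n + 1` ordered zeros of `D`;
* ★★ `threeLetterRiser_no_six_zeros_of_pull` — if `Pl > 0`, `Π₂ > d₁` on the interval, `Π₃` is monotone there, and `Π₄ = d₃` has NO THREE solutions in
  `{Π₃ > d₂}`, then `θH/(H − a) − Pl` (the total Euler ratio of the riser row against the pull; `a` free) does not vanish at six points of the interval —
  i.e. AT MOST FIVE zeros.  For a cloud of unswitched incoherent rows the three cloud facts hold (`Π₂`, `Π₃` increasing: p7 g15 memo §11 / ✓ `…CloudMonotone`;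
  «`Π₄` at most 2-to-1»: p5 g15 memo §4 (4), TEXT — the research piece of the kernel route), and five is attained (✓ `…ThreeLetterSharp`).

HONEST FRAMING: a real-variable reduction (Rolle ×12 with two divisions), cloud-agnostic; it closes nothing by itself; the K = 3 floor `OneChangeFloorK3` is NOT
affected; NOT `stub_polyLaw` / `MatrixDescartes` / B; `VP ≠ VNP` NOT proved.  No definitions, no named facts; Mathlib only.
-/

set_option linter.dupNamespace false

namespace Summit.ValiantsHypothesis.ValiantsHypothesis.Theorems.LacunarySymmetroidMatrixDescartes

namespace ProductPlusOne

/-! ### §1 Calculus: the chain's one identity, and Rolle for ordered tuples -/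

/-- **The chain identity:** for `F` differentiable at `t` with `F t ≠ c₀` and an exponent `n ≥ 1` with `(n : ℝ) = c − c₀`,
`(t ↦ t^n·(F t − c)/(F t − c₀))` has derivative `n·t^{n−1}·((F t − c)(F t − c₀) + t·F′)/(F t − c₀)²` at `t`. [folklore] -/
theorem hasDerivAt_pow_mul_ratio (F : ℝ → ℝ) {F' t c c₀ : ℝ} (n : ℕ) (hn : 1 ≤ n) (hnc : (n : ℝ) = c - c₀)
    (hF : HasDerivAt F F' t) (hc₀ : F t ≠ c₀) :
    HasDerivAt (fun s => s ^ n * ((F s - c) / (F s - c₀)))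
      ((n : ℝ) * t ^ (n - 1) * (((F t - c) * (F t - c₀) + t * F') / (F t - c₀) ^ 2)) t := by
  have hsub : F t - c₀ ≠ 0 := sub_ne_zero.mpr hc₀
  have h1 : HasDerivAt (fun s => s ^ n) ((n : ℝ) * t ^ (n - 1)) t := hasDerivAt_pow n t
  have h2 : HasDerivAt (fun s => (F s - c) / (F s - c₀)) ((F' * (F t - c₀) - (F t - c) * F') / (F t - c₀) ^ 2) t :=
    (hF.sub_const c).div (hF.sub_const c₀) hsub
  have h := h1.mul h2
  refine h.congr_deriv ?_
  obtain ⟨k, rfl⟩ : ∃ k, n = k + 1 := ⟨n - 1, by omega⟩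
  simp only [Nat.add_sub_cancel]
  push_cast at hnc ⊢
  field_simp
  rw [pow_succ]
  linear_combination (-(t * t ^ k * F')) * hnc

/-- **Rolle for an ordered tuple of zeros.**  `f` with derivative `f′ = g·D` (`g ≠ 0`) on `[x 0, x (last)]`; if `f` takes the SAME value at the
`n + 2` points of a strictly increasing tuple `x`, then `D` vanishes at `n + 1` strictly increasing points, the `i`-th strictly between `x i` and `x (i+1)`.
[folklore] -/
theorem exists_strictMono_deriv_zeros {n : ℕ} (f f' g D : ℝ → ℝ) (x : Fin (n + 2) → ℝ) (hx : StrictMono x) (a : ℝ)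
    (hder : ∀ t ∈ Set.Icc (x 0) (x (Fin.last (n + 1))), HasDerivAt f (f' t) t)
    (hfac : ∀ t ∈ Set.Icc (x 0) (x (Fin.last (n + 1))), f' t = g t * D t)
    (hg : ∀ t ∈ Set.Icc (x 0) (x (Fin.last (n + 1))), g t ≠ 0) (hzero : ∀ i, f (x i) = a) :
    ∃ ξ : Fin (n + 1) → ℝ, StrictMono ξ ∧ (∀ i, x (Fin.castSucc i) < ξ i ∧ ξ i < x (Fin.succ i)) ∧ ∀ i, D (ξ i) = 0 := by
  have h0 : ∀ i : Fin (n + 2), x 0 ≤ x i := fun i => hx.monotone (Fin.zero_le _)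
  have hL : ∀ i : Fin (n + 2), x i ≤ x (Fin.last (n + 1)) := fun i => hx.monotone (Fin.le_last _)
  have key : ∀ i : Fin (n + 1), ∃ ξ, x (Fin.castSucc i) < ξ ∧ ξ < x (Fin.succ i) ∧ D ξ = 0 := by
    intro i
    have hlt : x (Fin.castSucc i) < x (Fin.succ i) := hx (Fin.castSucc_lt_succ (i := i))
    have hsub : Set.Icc (x (Fin.castSucc i)) (x (Fin.succ i)) ⊆ Set.Icc (x 0) (x (Fin.last (n + 1))) :=
      Set.Icc_subset_Icc (h0 _) (hL _)
    have hcont : ContinuousOn f (Set.Icc (x (Fin.castSucc i)) (x (Fin.succ i))) :=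
      fun t ht => (hder t (hsub ht)).continuousAt.continuousWithinAt
    obtain ⟨ξ, hξ, hξ'⟩ := exists_hasDerivAt_eq_zero hlt hcont ((hzero _).trans (hzero _).symm)
      (fun t ht => hder t (hsub (Set.Ioo_subset_Icc_self ht)))
    have hξI : ξ ∈ Set.Icc (x 0) (x (Fin.last (n + 1))) := hsub (Set.Ioo_subset_Icc_self hξ)
    rw [hfac ξ hξI] at hξ'
    refine ⟨ξ, hξ.1, hξ.2, ?_⟩
    rcases mul_eq_zero.mp hξ' with h | h
    · exact absurd h (hg ξ hξI)
    · exact h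
  choose ξ hξl hξr hξD using key
  refine ⟨ξ, fun i j hij => ?_, fun i => ⟨hξl i, hξr i⟩, hξD⟩
  have hle : x (Fin.succ i) ≤ x (Fin.castSucc j) :=
    hx.monotone (by rw [Fin.le_iff_val_le_val]; simp; omega)
  exact (hξr i).trans_le (hle.trans (hξl j).le)

/-! ### §2 a-separation for the three-letter riser -/

/-- **`α′ = G₁/(x·Pl)`** for `α(t) = H(t) − θH(t)/Pl(t)`, `H = b₁t^{d₁} + b₂t^{d₂} + b₃t^{d₃}` (`d₁ = e₁+1`, `d₂ = e₁+e₂+2`, `d₃ = e₁+e₂+e₃+3`),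
`G₁ = Σ_l b_l d_l t^{d_l}(P2 − d_l)`, `P2 = Pl + t·Pl′/Pl` (`t > 0`, `Pl t ≠ 0`). [this file's lemma] -/
theorem threeLetter_alpha_hasDerivAt (e₁ e₂ e₃ : ℕ) (b₁ b₂ b₃ : ℝ) (Pl : ℝ → ℝ) {Pl' x : ℝ} (hx : 0 < x) (hPl : Pl x ≠ 0)
    (hder : HasDerivAt Pl Pl' x) :
    HasDerivAt (fun t : ℝ => b₁ * t ^ (e₁ + 1) + b₂ * t ^ (e₁ + e₂ + 2) + b₃ * t ^ (e₁ + e₂ + e₃ + 3)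
        - (((e₁ : ℝ) + 1) * b₁ * t ^ (e₁ + 1) + ((e₁ : ℝ) + e₂ + 2) * b₂ * t ^ (e₁ + e₂ + 2)
            + ((e₁ : ℝ) + e₂ + e₃ + 3) * b₃ * t ^ (e₁ + e₂ + e₃ + 3)) / Pl t)
      ((b₁ * ((e₁ : ℝ) + 1) * x ^ (e₁ + 1) * (Pl x + x * Pl' / Pl x - ((e₁ : ℝ) + 1))
        + b₂ * ((e₁ : ℝ) + e₂ + 2) * x ^ (e₁ + e₂ + 2) * (Pl x + x * Pl' / Pl x - ((e₁ : ℝ) + e₂ + 2))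
        + b₃ * ((e₁ : ℝ) + e₂ + e₃ + 3) * x ^ (e₁ + e₂ + e₃ + 3) * (Pl x + x * Pl' / Pl x - ((e₁ : ℝ) + e₂ + e₃ + 3)))
        / (x * Pl x)) x := by
  have hxne : x ≠ 0 := hx.ne'
  have hp1 : HasDerivAt (fun t : ℝ => t ^ (e₁ + 1)) (((e₁ + 1 : ℕ) : ℝ) * x ^ e₁) x := by
    simpa using hasDerivAt_pow (e₁ + 1) x
  have hp2 : HasDerivAt (fun t : ℝ => t ^ (e₁ + e₂ + 2)) (((e₁ + e₂ + 2 : ℕ) : ℝ) * x ^ (e₁ + e₂ + 1)) x := by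
    simpa using hasDerivAt_pow (e₁ + e₂ + 2) x
  have hp3 : HasDerivAt (fun t : ℝ => t ^ (e₁ + e₂ + e₃ + 3)) (((e₁ + e₂ + e₃ + 3 : ℕ) : ℝ) * x ^ (e₁ + e₂ + e₃ + 2)) x := by
    simpa using hasDerivAt_pow (e₁ + e₂ + e₃ + 3) x
  have hH : HasDerivAt (fun t : ℝ => b₁ * t ^ (e₁ + 1) + b₂ * t ^ (e₁ + e₂ + 2) + b₃ * t ^ (e₁ + e₂ + e₃ + 3))
      (b₁ * (((e₁ + 1 : ℕ) : ℝ) * x ^ e₁) + b₂ * (((e₁ + e₂ + 2 : ℕ) : ℝ) * x ^ (e₁ + e₂ + 1))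
        + b₃ * (((e₁ + e₂ + e₃ + 3 : ℕ) : ℝ) * x ^ (e₁ + e₂ + e₃ + 2))) x :=
    ((hp1.const_mul b₁).add (hp2.const_mul b₂)).add (hp3.const_mul b₃)
  have hT : HasDerivAt (fun t : ℝ => ((e₁ : ℝ) + 1) * b₁ * t ^ (e₁ + 1) + ((e₁ : ℝ) + e₂ + 2) * b₂ * t ^ (e₁ + e₂ + 2)
        + ((e₁ : ℝ) + e₂ + e₃ + 3) * b₃ * t ^ (e₁ + e₂ + e₃ + 3))
      (((e₁ : ℝ) + 1) * b₁ * (((e₁ + 1 : ℕ) : ℝ) * x ^ e₁) + ((e₁ : ℝ) + e₂ + 2) * b₂ * (((e₁ + e₂ + 2 : ℕ) : ℝ) * x ^ (e₁ + e₂ + 1))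
        + ((e₁ : ℝ) + e₂ + e₃ + 3) * b₃ * (((e₁ + e₂ + e₃ + 3 : ℕ) : ℝ) * x ^ (e₁ + e₂ + e₃ + 2))) x :=
    ((hp1.const_mul _).add (hp2.const_mul _)).add (hp3.const_mul _)
  have hall := hH.sub (hT.div hder hPl)
  refine hall.congr_deriv ?_
  have hx1 : x ^ (e₁ + 1) = x ^ e₁ * x := pow_succ x e₁
  have hx2 : x ^ (e₁ + e₂ + 2) = x ^ (e₁ + e₂ + 1) * x := pow_succ x (e₁ + e₂ + 1)
  have hx3 : x ^ (e₁ + e₂ + e₃ + 3) = x ^ (e₁ + e₂ + e₃ + 2) * x := pow_succ x (e₁ + e₂ + e₃ + 2)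
  rw [hx1, hx2, hx3]
  push_cast
  field_simp
  ring

/-! ### §3 The abstract storey: no six zeros -/

/-- ★★ **THE THREE-LETTER RISER AGAINST A GENERAL PULL HAS NO SIX ZEROS.**  Exponents `d₁ = e₁+1 < d₂ = e₁+e₂+2 < d₃ = e₁+e₂+e₃+3`, letters
`b₁, b₂, b₃ > 0`, bottom coefficient `a` FREE; a pull `Pl > 0` with derivative `Pl′` on `[x 0, x 5] ⊂ (0,∞)`; `P2 = Pl + t·Pl′/Pl` with derivative `P2′` and
`P2 > d₁` there; `P3 = P2 + t·P2′/(P2 − d₁)` with derivative `P3′`, MONOTONE (non-decreasing) there; and the one cloud fact of the storey: `P4 = d₃`, i.e.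
`(P3 − d₃)(P3 − d₂) + t·P3′ = 0`, has NO THREE solutions `y₁ < y₂ < y₃` in the interval with `P3 > d₂`.  Then the total Euler ratio of the riser row against
the pull, `θH/(H − a) − Pl`, does not vanish at six points `x 0 < x 1 < ⋯ < x 5` (with `H(x i) ≠ a`).  (Proof: a-separation ✓ `threeLetter_alpha_hasDerivAt`,
then Rolle ×5, division by `b₁d₁t^{d₁}(P2 − d₁)`, Rolle ×4, division by `(P3 − d₂)`, Rolle ×3 — ✓ `hasDerivAt_pow_mul_ratio` is the derivative of each
storey.) [this file's theorem] -/
theorem threeLetterRiser_no_six_zeros_of_pull (e₁ e₂ e₃ : ℕ) {a b₁ b₂ b₃ : ℝ} (hb₁ : 0 < b₁) (hb₂ : 0 < b₂) (hb₃ : 0 < b₃)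
    (Pl Pl' P2' P3 P3' : ℝ → ℝ) (x : Fin 6 → ℝ) (hx : StrictMono x) (h0 : 0 < x 0)
    (hPl : ∀ t ∈ Set.Icc (x 0) (x 5), HasDerivAt Pl (Pl' t) t) (hPlpos : ∀ t ∈ Set.Icc (x 0) (x 5), 0 < Pl t)
    (hP2 : ∀ t ∈ Set.Icc (x 0) (x 5), HasDerivAt (fun s => Pl s + s * Pl' s / Pl s) (P2' t) t)
    (hP2gt : ∀ t ∈ Set.Icc (x 0) (x 5), ((e₁ : ℝ) + 1) < Pl t + t * Pl' t / Pl t)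
    (hP3def : ∀ t ∈ Set.Icc (x 0) (x 5),
      P3 t = (Pl t + t * Pl' t / Pl t) + t * P2' t / ((Pl t + t * Pl' t / Pl t) - ((e₁ : ℝ) + 1)))
    (hP3 : ∀ t ∈ Set.Icc (x 0) (x 5), HasDerivAt P3 (P3' t) t) (hP3mono : MonotoneOn P3 (Set.Icc (x 0) (x 5)))
    (hP4 : ∀ y₁ y₂ y₃ : ℝ, x 0 ≤ y₁ → y₁ < y₂ → y₂ < y₃ → y₃ ≤ x 5 → ((e₁ : ℝ) + e₂ + 2) < P3 y₁ →
      (P3 y₁ - ((e₁ : ℝ) + e₂ + e₃ + 3)) * (P3 y₁ - ((e₁ : ℝ) + e₂ + 2)) + y₁ * P3' y₁ = 0 →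
      (P3 y₂ - ((e₁ : ℝ) + e₂ + e₃ + 3)) * (P3 y₂ - ((e₁ : ℝ) + e₂ + 2)) + y₂ * P3' y₂ = 0 →
      (P3 y₃ - ((e₁ : ℝ) + e₂ + e₃ + 3)) * (P3 y₃ - ((e₁ : ℝ) + e₂ + 2)) + y₃ * P3' y₃ = 0 → False)
    (hne : ∀ i, b₁ * x i ^ (e₁ + 1) + b₂ * x i ^ (e₁ + e₂ + 2) + b₃ * x i ^ (e₁ + e₂ + e₃ + 3) ≠ a)
    (hzero : ∀ i, (((e₁ : ℝ) + 1) * b₁ * x i ^ (e₁ + 1) + ((e₁ : ℝ) + e₂ + 2) * b₂ * x i ^ (e₁ + e₂ + 2)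
        + ((e₁ : ℝ) + e₂ + e₃ + 3) * b₃ * x i ^ (e₁ + e₂ + e₃ + 3))
        / (b₁ * x i ^ (e₁ + 1) + b₂ * x i ^ (e₁ + e₂ + 2) + b₃ * x i ^ (e₁ + e₂ + e₃ + 3) - a) - Pl (x i) = 0) :
    False := by
  -- names
  set d₁ : ℝ := (e₁ : ℝ) + 1 with hd₁
  set d₂ : ℝ := (e₁ : ℝ) + e₂ + 2 with hd₂
  set d₃ : ℝ := (e₁ : ℝ) + e₂ + e₃ + 3 with hd₃
  set I : Set ℝ := Set.Icc (x 0) (x 5) with hI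
  set H : ℝ → ℝ := fun t => b₁ * t ^ (e₁ + 1) + b₂ * t ^ (e₁ + e₂ + 2) + b₃ * t ^ (e₁ + e₂ + e₃ + 3) with hH
  set T : ℝ → ℝ := fun t => d₁ * b₁ * t ^ (e₁ + 1) + d₂ * b₂ * t ^ (e₁ + e₂ + 2) + d₃ * b₃ * t ^ (e₁ + e₂ + e₃ + 3) with hT
  set P2 : ℝ → ℝ := fun t => Pl t + t * Pl' t / Pl t with hP2eq
  set α : ℝ → ℝ := fun t => H t - T t / Pl t with hα
  set G₁ : ℝ → ℝ := fun t => b₁ * d₁ * t ^ (e₁ + 1) * (P2 t - d₁) + b₂ * d₂ * t ^ (e₁ + e₂ + 2) * (P2 t - d₂)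
      + b₃ * d₃ * t ^ (e₁ + e₂ + e₃ + 3) * (P2 t - d₃) with hG₁
  have hd₁pos : 0 < d₁ := by rw [hd₁]; positivity
  have hd₂pos : 0 < d₂ := by rw [hd₂]; positivity
  have hd₃pos : 0 < d₃ := by rw [hd₃]; positivity
  have hposI : ∀ t ∈ I, 0 < t := fun t ht => h0.trans_le ht.1
  have hxI : ∀ i, x i ∈ I := fun i => ⟨hx.monotone (Fin.zero_le _), hx.monotone (Fin.le_last _)⟩
  -- (1) the six zeros are a level set of α
  have hαa : ∀ i, α (x i) = a := by
    intro i
    have hN := (hPlpos (x i) (hxI i)).ne'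
    have hh : b₁ * x i ^ (e₁ + 1) + b₂ * x i ^ (e₁ + e₂ + 2) + b₃ * x i ^ (e₁ + e₂ + e₃ + 3) - a ≠ 0 :=
      sub_ne_zero.mpr (hne i)
    have e1 : T (x i) = Pl (x i) * (H (x i) - a) := by
      have h := sub_eq_zero.1 (hzero i)
      rw [div_eq_iff hh] at h
      simp only [hT, hH]
      linarith
    have hh' : H (x i) - a ≠ 0 := by simpa only [hH] using hh
    simp only [hα]
    rw [e1]
    field_simp
    ring
  -- (2) α′ = G₁/(t·Pl): five zeros of G₁
  have hderα : ∀ t ∈ I, HasDerivAt α (G₁ t / (t * Pl t)) t := by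
    intro t ht
    have h := threeLetter_alpha_hasDerivAt e₁ e₂ e₃ b₁ b₂ b₃ Pl (hposI t ht) (hPlpos t ht).ne' (hPl t ht)
    simp only [hα, hH, hT, hG₁, hP2eq, hd₁, hd₂, hd₃]
    convert h using 1
  obtain ⟨ξ, hξmono, hξbet, hξzero⟩ := exists_strictMono_deriv_zeros (n := 4) α (fun t => G₁ t / (t * Pl t))
    (fun t => 1 / (t * Pl t)) G₁ x hx a hderα (fun t _ => by ring)
    (fun t ht => one_div_ne_zero (mul_ne_zero (hposI t ht).ne' (hPlpos t ht).ne')) hαa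
  have hξI : ∀ i, ξ i ∈ I := fun i =>
    ⟨(hxI _).1.trans (hξbet i).1.le, (hξbet i).2.le.trans (hxI _).2⟩
  have hIξ : Set.Icc (ξ 0) (ξ (Fin.last 4)) ⊆ I := Set.Icc_subset_Icc (hξI 0).1 (hξI _).2
  -- (3) β := G₁/(b₁d₁t^{d₁}(P2 − d₁)) and β′ = G₂/(t(P2 − d₁)): four zeros of G₂
  set κ₂ : ℝ := b₂ * d₂ / (b₁ * d₁) with hκ₂
  set κ₃ : ℝ := b₃ * d₃ / (b₁ * d₁) with hκ₃
  have hκ₂pos : 0 < κ₂ := by rw [hκ₂]; positivity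
  have hκ₃pos : 0 < κ₃ := by rw [hκ₃]; positivity
  set β : ℝ → ℝ := fun t => 1 + κ₂ * (t ^ (e₂ + 1) * ((P2 t - d₂) / (P2 t - d₁)))
      + κ₃ * (t ^ (e₂ + e₃ + 2) * ((P2 t - d₃) / (P2 t - d₁))) with hβ
  set G₂ : ℝ → ℝ := fun t => κ₂ * (d₂ - d₁) * t ^ (e₂ + 1) * (P3 t - d₂) + κ₃ * (d₃ - d₁) * t ^ (e₂ + e₃ + 2) * (P3 t - d₃) with hG₂
  have hβzero : ∀ i, β (ξ i) = 0 := by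
    intro i
    have ht := hξI i
    have ht0 := hposI _ ht
    have hgap : P2 (ξ i) - d₁ ≠ 0 := (sub_pos.mpr (hP2gt _ ht)).ne'
    have hG : G₁ (ξ i) = 0 := hξzero i
    -- β · (b₁ d₁ t^{d₁} (P2 − d₁)) = G₁
    have hrel : β (ξ i) * (b₁ * d₁ * ξ i ^ (e₁ + 1) * (P2 (ξ i) - d₁)) = G₁ (ξ i) := by
      simp only [hβ, hG₁, hκ₂, hκ₃]
      field_simp
      ring
    rw [hG] at hrel
    have hne0 : b₁ * d₁ * ξ i ^ (e₁ + 1) * (P2 (ξ i) - d₁) ≠ 0 := by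
      refine mul_ne_zero (mul_ne_zero (mul_ne_zero hb₁.ne' hd₁pos.ne') (pow_ne_zero _ ht0.ne')) hgap
    exact (mul_eq_zero.mp hrel).resolve_right hne0
  have hderβ : ∀ t ∈ Set.Icc (ξ 0) (ξ (Fin.last 4)), HasDerivAt β
      (κ₂ * (((e₂ + 1 : ℕ) : ℝ) * t ^ (e₂ + 1 - 1) * (((P2 t - d₂) * (P2 t - d₁) + t * P2' t) / (P2 t - d₁) ^ 2))
        + κ₃ * (((e₂ + e₃ + 2 : ℕ) : ℝ) * t ^ (e₂ + e₃ + 2 - 1) * (((P2 t - d₃) * (P2 t - d₁) + t * P2' t) / (P2 t - d₁) ^ 2))) t := by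
    intro t ht'
    have ht := hIξ ht'
    have hgap : P2 t ≠ d₁ := (hP2gt t ht).ne'
    have hF : HasDerivAt P2 (P2' t) t := hP2 t ht
    have h2 := hasDerivAt_pow_mul_ratio P2 (c := d₂) (c₀ := d₁) (e₂ + 1) (by omega) (by rw [hd₁, hd₂]; push_cast; ring) hF hgap
    have h3 := hasDerivAt_pow_mul_ratio P2 (c := d₃) (c₀ := d₁) (e₂ + e₃ + 2) (by omega) (by rw [hd₁, hd₃]; push_cast; ring) hF hgap
    exact ((h2.const_mul κ₂).const_add 1).add (h3.const_mul κ₃)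
  obtain ⟨η, hηmono, hηbet, hηzero⟩ := exists_strictMono_deriv_zeros (n := 3) β _ (fun t => 1 / (t * (P2 t - d₁))) G₂ ξ hξmono 0
    hderβ
    (by
      intro t ht'
      have ht := hIξ ht'
      have ht0 := hposI t ht
      have hgap : P2 t - d₁ ≠ 0 := (sub_pos.mpr (hP2gt t ht)).ne'
      have hP3' : P3 t = P2 t + t * P2' t / (P2 t - d₁) := hP3def t ht
      simp only [hG₂, Nat.add_sub_cancel]
      rw [hP3']
      have hx1 : t ^ (e₂ + 1) = t ^ e₂ * t := pow_succ t e₂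
      have hx2 : t ^ (e₂ + e₃ + 2) = t ^ (e₂ + e₃ + 1) * t := pow_succ t (e₂ + e₃ + 1)
      rw [hx1, hx2]
      simp only [hd₁, hd₂, hd₃] at hgap ⊢
      push_cast
      field_simp
      ring)
    (fun t ht' => by
      have ht := hIξ ht'
      exact one_div_ne_zero (mul_ne_zero (hposI t ht).ne' (sub_pos.mpr (hP2gt t ht)).ne'))
    hβzero
  have hηI : ∀ i, η i ∈ I := fun i =>
    ⟨(hξI _).1.trans (hηbet i).1.le, (hηbet i).2.le.trans (hξI _).2⟩
  -- zeros of G₂ have P3 > d₂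
  have hηgt : ∀ i, d₂ < P3 (η i) := by
    intro i
    by_contra hle
    push Not at hle
    have ht0 := hposI _ (hηI i)
    have h12 : d₁ < d₂ := by rw [hd₁, hd₂]; linarith
    have h13 : d₁ < d₃ := by rw [hd₁, hd₃]; linarith
    have h23 : d₂ < d₃ := by rw [hd₂, hd₃]; linarith
    have hA : 0 ≤ κ₂ * (d₂ - d₁) * η i ^ (e₂ + 1) :=
      mul_nonneg (mul_nonneg hκ₂pos.le (by linarith)) (pow_nonneg ht0.le _)
    have hB : 0 < κ₃ * (d₃ - d₁) * η i ^ (e₂ + e₃ + 2) :=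
      mul_pos (mul_pos hκ₃pos (by linarith)) (pow_pos ht0 _)
    have h1 : κ₂ * (d₂ - d₁) * η i ^ (e₂ + 1) * (P3 (η i) - d₂) ≤ 0 :=
      mul_nonpos_of_nonneg_of_nonpos hA (by linarith)
    have h2 : κ₃ * (d₃ - d₁) * η i ^ (e₂ + e₃ + 2) * (P3 (η i) - d₃) < 0 :=
      mul_neg_of_pos_of_neg hB (by linarith)
    have : G₂ (η i) < 0 := by simp only [hG₂]; linarith
    exact absurd (hηzero i) this.ne
  have hIη : Set.Icc (η 0) (η (Fin.last 3)) ⊆ I := Set.Icc_subset_Icc (hηI 0).1 (hηI _).2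
  have hgt2 : ∀ t ∈ Set.Icc (η 0) (η (Fin.last 3)), d₂ < P3 t := fun t ht =>
    (hηgt 0).trans_le (hP3mono (hηI 0) (hIη ht) ht.1)
  -- (4) γ := G₂/(κ₂(d₂−d₁)t^{e₂+1}(P3 − d₂)), γ′ ∝ (P3 − d₃)(P3 − d₂) + tP3′: three solutions of P4 = d₃
  set κ' : ℝ := κ₃ * (d₃ - d₁) / (κ₂ * (d₂ - d₁)) with hκ'
  have hκ'pos : 0 < κ' := by
    have : d₁ < d₂ := by rw [hd₁, hd₂]; linarith
    have : d₁ < d₃ := by rw [hd₁, hd₃]; linarith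
    rw [hκ']; positivity
  set γ : ℝ → ℝ := fun t => 1 + κ' * (t ^ (e₃ + 1) * ((P3 t - d₃) / (P3 t - d₂))) with hγ
  set D₃ : ℝ → ℝ := fun t => (P3 t - d₃) * (P3 t - d₂) + t * P3' t with hD₃
  have hγzero : ∀ i, γ (η i) = 0 := by
    intro i
    have ht0 := hposI _ (hηI i)
    have hgap : P3 (η i) - d₂ ≠ 0 := (sub_pos.mpr (hηgt i)).ne'
    have hG : G₂ (η i) = 0 := hηzero i
    have hrel : γ (η i) * (κ₂ * (d₂ - d₁) * η i ^ (e₂ + 1) * (P3 (η i) - d₂)) = G₂ (η i) := by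
      have hd21 : d₂ - d₁ ≠ 0 := by rw [hd₁, hd₂]; intro h; linarith
      have hκ₂ne : κ₂ ≠ 0 := hκ₂pos.ne'
      simp only [hγ, hG₂, hκ']
      field_simp
      ring
    rw [hG] at hrel
    have hne0 : κ₂ * (d₂ - d₁) * η i ^ (e₂ + 1) * (P3 (η i) - d₂) ≠ 0 := by
      have : d₁ < d₂ := by rw [hd₁, hd₂]; linarith
      exact mul_ne_zero (mul_ne_zero (by positivity) (pow_ne_zero _ ht0.ne')) hgap
    exact (mul_eq_zero.mp hrel).resolve_right hne0
  have hderγ : ∀ t ∈ Set.Icc (η 0) (η (Fin.last 3)), HasDerivAt γ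
      (κ' * (((e₃ + 1 : ℕ) : ℝ) * t ^ (e₃ + 1 - 1) * (((P3 t - d₃) * (P3 t - d₂) + t * P3' t) / (P3 t - d₂) ^ 2))) t := by
    intro t ht'
    have ht := hIη ht'
    have hgap : P3 t ≠ d₂ := (hgt2 t ht').ne'
    have h := hasDerivAt_pow_mul_ratio P3 (c := d₃) (c₀ := d₂) (e₃ + 1) (by omega) (by rw [hd₂, hd₃]; push_cast; ring) (hP3 t ht) hgap
    exact (h.const_mul κ').const_add 1
  obtain ⟨ζ, hζmono, hζbet, hζzero⟩ := exists_strictMono_deriv_zeros (n := 2) γ _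
    (fun t => κ' * (((e₃ + 1 : ℕ) : ℝ) * t ^ (e₃ + 1 - 1)) / (P3 t - d₂) ^ 2) D₃ η hηmono 0 hderγ
    (fun t _ => by simp only [hD₃]; ring)
    (fun t ht' => by
      have ht := hIη ht'
      have ht0 := hposI t ht
      have hgap : P3 t - d₂ ≠ 0 := (sub_pos.mpr (hgt2 t ht')).ne'
      have : (0 : ℝ) < ((e₃ + 1 : ℕ) : ℝ) := by positivity
      simp only [Nat.add_sub_cancel]
      exact div_ne_zero (mul_ne_zero hκ'pos.ne' (mul_ne_zero this.ne' (pow_ne_zero _ ht0.ne'))) (pow_ne_zero _ hgap))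
    hγzero
  have hζI : ∀ i, ζ i ∈ Set.Icc (η 0) (η (Fin.last 3)) := fun i =>
    ⟨(hηmono.monotone (Fin.zero_le _)).trans (hζbet i).1.le, (hζbet i).2.le.trans (hηmono.monotone (Fin.le_last _))⟩
  -- (5) three solutions of P4 = d₃ with P3 > d₂: excluded
  refine hP4 (ζ 0) (ζ 1) (ζ 2) ((hηI 0).1.trans (hζI 0).1) (hζmono (by decide)) (hζmono (by decide))
    ((hζI 2).2.trans (hηI _).2) (hgt2 _ (hζI 0)) ?_ ?_ ?_
  · simpa only [hD₃] using hζzero 0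
  · simpa only [hD₃] using hζzero 1
  · simpa only [hD₃] using hζzero 2

end ProductPlusOne

end Summit.ValiantsHypothesis.ValiantsHypothesis.Theorems.LacunarySymmetroidMatrixDescartes
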